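import Summits.ResolutionOfSingularities.ResolutionOfSingularities.Theorems.PerronMonomialization
import HarnessLib

/-!
# PerronInitialChartPrelim — decomp-res node «PerronLadder» (lens-1 g17 KaplanskyLadder → g18 PerronLadder),
tree file 7/11 of the node

Content VERBATIM from the decomp-res lens-1 g18 file `HOME/decomp-res-lens-1/g18/PerronLadder.lean` (sha256
8bb02ceefe11b749, 3725 l; it SUPERSEDES
g17 `KaplanskyLadder.lean` fb35e2e5 ⊇ g16 `ToricLadder.lean` 67376591 as landing source; PARTS I–III = the
landed `Theorems/ToricLadderCells`,
`ToricLadderKernels`, `ToricLadderLinks`, `ToricLadderDense`, `ToricLadder` — not repeated).  HOME =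
run/shared/lean/pub/decomp-res.  Critic:
CRITIC-LEDGER rows 131 (g17, 2026-08-30T18:47:14Z) and 138 (g18 CLEARED, landing order 2026-08-30T20:05:14Z); the
lens's WRITER.md (endorsed).
Landed by decomp-res writer g7 as SUPPORT of the Valuative route item 0641 `LuAlphaPTorsor` (helper files; no
Valuative route edit is made by the
decomp-res cell: the support ports Σ₁ `MonoidalStep` / Π₁ `KK05NCVAscent`, the retirement of g16's all-rank
`ToricAscent 3` in favour of the theorem
`toricAscentRk1_three`, and the UNCHANGED located residual `NonKHToricArchLU 3 3 4` / port-free `NonKHArchLU 3 4`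
stay documented tree definitions
for the Valuative tenure / operator to book).

PART V-E (g18 NEW) §21, preliminaries: `rangeSubalgebra`, `ringKrullDim_le_of_fg_subset`,
`ringKrullDim_le_of_regChart` (dimension of a
regular chart dominated by the valuation).  PROVED, 0 sorry.  The initial chart itself: `PerronInitialChart`.

[WRITER NOTE (decomp-res writer g7): namespaces `…Theses.PerronLadder` ↦ `…Theorems.KaplanskyLadder` (PART IV
= g17 §14–§16, files
`KaplanskyLadder`, `KaplanskyLadderDefectless`) and ↦ `…Theorems.PerronLadder` (PART V, files `PerronMerge`
§17, `PerronCharts` §18–§19,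
`PerronMonomialization` §20, `PerronInitialChartPrelim` + `PerronInitialChart` §21 (400-line limit),
`PerronRepresentations` §22, `PerronAscent`
§23, `PerronLadder` §24; PART IV likewise `KaplanskyHensel` §14 / `KaplanskyLadder` §15), with `open
…Theorems.ToricLadder` (+ `…KaplanskyLadder`) so the lens's unqualified references stay verbatim; `section PartV` and its
section-scoped `open`s re-opened per file; the g16 helper `intermediateField_top_fg` is the landed
`PfaffLine.intermediateField_top_fg_of_isFractionRing`
(renamed at its use, as in the landed `ToricLadder`); global `set_option` lines dropped; nothing else changed.]

(Sources: CossartPiltant2019; CossartJannsenSaito2020; KnafKuhlmann2005 arXiv:math/0304159 §4 Thm 4.1, Lemmas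
4.2–4.4; KnafKuhlmann2009 arXiv:math/0702856 Prop 3.11, Thm 1.5; Kaplansky1942 Lemma 5, Thm 3; Kuhlmann2010 Thm
2.14; Zariski1940 §B; Cutkosky arXiv:1404.7459 §2.1; ZariskiSamuelII.)
-/

noncomputable section

open IsLocalRing Literature.AlgebraicGeometry.Resolution
open Summit.ResolutionOfSingularities.ResolutionOfSingularities.Theses
open Summit.ResolutionOfSingularities.ResolutionOfSingularities.Theorems
open Summit.ResolutionOfSingularities.ResolutionOfSingularities.Theorems.PfaffLine
open Summit.ResolutionOfSingularities.ResolutionOfSingularities.Theorems.ToricLadder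

namespace Summit.ResolutionOfSingularities.ResolutionOfSingularities.Theorems.PerronLadder

section PartV

open Finset
open CategoryTheory CategoryTheory.Limits AlgebraicGeometry TopologicalSpace
open Scheme.IdealSheafData
open scoped Classical

/-! ## 21. PART V-E · KERNEL: the initial chart (CJS) -/

section InitialChart

variable {k : Type} [Field k] {K : Type} [Field K] [Algebra k K]

/-- The range of a ring map into `K` containing the constants is a `k`-subalgebra. -/
def rangeSubalgebra {R' : Type} [CommRing R'] (f : R' →+* K)
    (hk : ∀ c : k, algebraMap k K c ∈ Set.range f) : Subalgebra k K :=
  { f.range with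
    algebraMap_mem' := fun c => by
      obtain ⟨r, hr⟩ := hk c
      exact ⟨r, hr⟩ }

/-- `mem_rangeSubalgebra`: Auxiliary step of this node's calculus, VERBATIM from the lens file (see the module
docstring); the statement is its type. [folklore] -/
theorem mem_rangeSubalgebra {R' : Type} [CommRing R'] (f : R' →+* K)
    (hk : ∀ c : k, algebraMap k K c ∈ Set.range f) (y : K) :
    y ∈ rangeSubalgebra f hk ↔ ∃ r, f r = y := RingHom.mem_range

/-- `dim C ≤ e` for a finitely generated `k`-subalgebra `C` of a subfield of transcendence degree `≤ e`
(the dimension theorem for affine domains). [folklore] -/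
theorem ringKrullDim_le_of_fg_subset (C : Subalgebra k K) (hC : C.FG) (F₁ : IntermediateField k K)
    (hCF : ∀ y, y ∈ C → y ∈ F₁) {e : ℕ} (htr : Algebra.trdeg k F₁ ≤ e) : ringKrullDim C ≤ e := by
  haveI : Algebra.FiniteType k C := C.fg_iff_finiteType.mp hC
  obtain ⟨n, hn, htrC⟩ := exists_ringKrullDim_eq_and_trdeg_eq k C
  let f : C →ₐ[k] F₁ :=
    { toFun := fun c => ⟨(c : K), hCF _ c.2⟩
      map_one' := rfl
      map_mul' := fun _ _ => rfl
      map_zero' := rfl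
      map_add' := fun _ _ => rfl
      commutes' := fun _ => rfl }
  have hf : Function.Injective f := fun a b h =>
    Subtype.ext (congrArg (fun x : F₁ => (x : K)) h)
  have h := trdeg_le_of_injective f hf
  rw [htrC] at h
  rw [hn]
  exact_mod_cast h.trans htr

/-- **The dimension of a regular local chart of `F₁` is at most `trdeg_k F₁`**: the chart is a
localization of its finitely generated presentation ring `C ⊆ F₁`. [folklore] -/
theorem ringKrullDim_le_of_regChart (O : ValuationSubring K) (F₁ : IntermediateField k K)
    {S : Subalgebra k K} (hS : RegChart O F₁ S) {e : ℕ} (htr : Algebra.trdeg k F₁ ≤ e) :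
    ringKrullDim S ≤ e := by
  obtain ⟨-, -, hSF, hunit, -, C, hCfg, hCS, hpres⟩ := hS
  let M : Submonoid C :=
    { carrier := {c | O.valuation (c : K) = 1}
      mul_mem' := fun {a b} ha hb => by
        simp only [Set.mem_setOf_eq] at ha hb ⊢
        rw [Subalgebra.coe_mul, map_mul, ha, hb, mul_one]
      one_mem' := by simp }
  letI : Algebra C S := (Subalgebra.inclusion hCS).toRingHom.toAlgebra
  have halg : ∀ c : C, ((algebraMap C S c : S) : K) = (c : K) := fun _ => rfl
  haveI : IsLocalization M S :=
    { map_units := fun y => (hunit _).mpr (by rw [halg]; exact y.2)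
      surj := fun s => by
        obtain ⟨a, haC, b, hbC, hb1, hsb⟩ := hpres s s.2
        exact ⟨(⟨a, haC⟩, ⟨⟨b, hbC⟩, hb1⟩), Subtype.ext hsb⟩
      exists_of_eq := fun {a b} h => ⟨1, by
        have h' : (a : K) = (b : K) := by rw [← halg a, ← halg b, h]
        rw [Subtype.ext h']⟩ }
  calc ringKrullDim S ≤ ringKrullDim C :=
        Literature.RingTheory.KrullDimension.ringKrullDim_le_of_isLocalization M S
    _ ≤ e := ringKrullDim_le_of_fg_subset C hCfg F₁ (fun c hc => hSF (hCS hc)) htr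

end InitialChart

end PartV

end Summit.ResolutionOfSingularities.ResolutionOfSingularities.Theorems.PerronLadder
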